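import Literature.NumberTheory.EllipticCurves.Hsieh2014.AnticyclotomicMuInvariantAnyLevel
import Literature.NumberTheory.EllipticCurves.PAdicHeights
import HarnessLib

/-!
# Hsieh 2014, Theorems A and B (= Thm. 1–2 of the e-print) WITH ONE `K`-RAMIFIED STEINBERG PRIME:
# `𝔫⁻ = 𝔮`, `q ‖ N`, `q ∣ d_K`, `a_q = −1` (non-split multiplicative), every other `ℓ ∣ N` split in `K`,
# any level at `p` — two named facts, the variants of `Hsieh2014.thmA_exists_isHsiehLFunction_unrPeriod_anyLevel`
# and `Hsieh2014.thmB_exists_isHsiehLFunction_coeff_norm_eq_one_unrPeriod_anyLevel` with the binder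
# (S4) `SatisfiesHeegnerHypothesis N K` (`𝔫⁻ = 1`) REPLACED by the one-ramified-Steinberg-prime configuration

Topic `NumberTheory/EllipticCurves`, sub-directory `Hsieh2014` (namespace = path). Companion of
`Hsieh2014/AnticyclotomicPAdicLFunctionAnyLevel.lean` (Thm. A at every level),
`Hsieh2014/AnticyclotomicMuInvariantAnyLevel.lean` (Thm. B at every level) and of the frame file
`AnticyclotomicRankinSelbergPAdicLFunction.lean`, whose predicate `IsHsiehLFunction`, display
`hsiehInterpolationValue`, receptacle `PowerSeries (PadicComplexInt p) = 𝒪_{ℂ_p}⟦T⟧`, binders, dictionary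
((S1)–(S8), (W1)–(W4), (E1)–(E2), (E1″)) and ERRATUM E-G131-1 are used VERBATIM and not restated. Item
wi-88449 (cell `bsd-stepL`, guest typer `defn-ty1` g23) for the consumer crux stmt-BirchSwinnertonDyer-19358
(route `AdditiveBranchIMC`, decl `GordTwoRankOne`), registered line
`Summits/BirchSwinnertonDyer/BirchSwinnertonDyer/Cruxes/GordTwoRankOne/Lines/wan_tame_bdp_road.lean`,
stub `stub_wanHsiehLowerBoundOverK`, inputs (S_μ) "`μ = 0`" and (S3-frame) "existence of `𝒫_Σ(π_E, λ)` at an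
additive `p` split in `K`" on the JSW-type field `K` of the tree fact
`friedbergHoffstein_exists_twist_ne_zero_ramifiedAt_splitAt` (`q` RAMIFIED in `K`, every other prime of `N`
split, `p` split): there the tree's four Theorem A/B facts are SILENT because of their binder
`SatisfiesHeegnerHypothesis N K` ((S4): every `ℓ ∣ N` splits, `𝔫⁻ = 1`). HONEST FRAMING: TWO named facts
(`def … : Prop`, nothing asserted, no `_holds`; net debt +2, as the item asks) whose binders are those of the
two any-level facts IN THE SAME ORDER with (S4) replaced by the configuration (S4′) below — this file holds the
STATEMENTS ONLY; the kernel bookkeeping is PROVED in the sibling proof file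
`AnticyclotomicPAdicLFunctionRamifiedSteinbergCorollaries.lean`: the Thm. B variant yields a Thm. A-shaped frame
and a frame with `Q ≠ 0`, the Thm. A variant yields the norm-one-period form, and — "nothing new on the all-split
range" — the configuration (S4′) is DISJOINT from (S4) (`not_satisfiesHeegnerHypothesis_of_dvd_discr`: a prime
dividing `d_K` does not split in the quadratic field `K`, `ncard_primesOver_ne_two_of_dvd_discr`, proved there from
Mathlib's Dedekind discriminant theorem and the fundamental identity), so neither variant restates, strengthens
or overlaps the existing facts.
Nothing about the stub, the crux, the route or any case of BSD is proved or claimed.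

## Source (Hsieh, *Special values of anticyclotomic Rankin–Selberg L-functions*, Doc. Math. 19 (2014)
## 709–767 = arXiv:1112.1580; locators `[p. …]` = the 3000-character chunks of the held TeX text
## `paper:arxiv-1112.1580` as in the companions; print names by ERRATUM E-G131-1 of the frame file:
## Thm. 1 = Thm. A (p. 712) = Thm. 5.6 [p. 23] = Thm. 5.7 (p. 754), Thm. 2 = Thm. B (p. 713) = Thm. 6.2
## [p. 25] (p. 757), Hypothesis 1 = Hypothesis A (p. 710)) — read 2026-08-28

What the printed theorems allow at the non-split primes. [p. 3 ll. 14–16]: "For each ideal `𝔞` of `𝓕` … a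
unique factorization `𝔞 = 𝔞⁺𝔞⁻`, where `𝔞⁺` is only divisible by primes split in `𝓚` and `𝔞⁻` is divisible by
primes INERT OR RAMIFIED in `𝓚`. Let `𝔫 = 𝔫⁺𝔫⁻` be the conductor of `π`." [p. 3 l. 22]: "**Hypothesis 1.** The
local root number `ε*(π_{𝓚_v}, λ_v) = +1` for each `v ∣ 𝔫⁻`", where `ε*(π_{𝓚_v}, λ_v) := ε(½, π_{𝓚_v} ⊗ λ_v, ψ_v)·
ω_v(−1)` [p. 3 ll. 17–19]. [p. 4 ll. 13–18]: "**Theorem 1.** In addition to (ord) and Hypothesis 1, we further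
assume that (sf) `𝔫⁻` is square-free. Then there exists `𝒫_Σ(π, λ) ∈ Λ` such that …" (display quoted in full in
the frame file; `C(π, λ) ∈ Z̄_{(p)}^×` "an explicit unit independent of `φ`, consisting of a product of local
epsilon factors outside `p`"); [p. 4 l. 22]: "When `𝓕 = ℚ`, `π` is unramified at `p` and `𝔫⁻` is only
divisible by primes ramified in `𝓚`, `𝓛_Σ(π, λ)` is constructed in [BDP]" — the ramified-only `𝔫⁻` IS in the
scope of Thm. 1. [p. 4 ll. 31–37]: "**Theorem 2.** With the assumptions in Theorem 1, suppose further that (1) `p`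
is unramified in `𝓕`, (2) … `ρ̄_p(π_𝓚)` is absolutely irreducible, (3) `p ∤ ∏_{v∣𝔠_λ⁻} #(Δ_{λ,v})`. Then
`μ⁻_{π,λ,Σ} = 0`." The body: [p. 10] "`𝔫⁻ = 𝔫⁻_s 𝔫⁻_r`, where `𝔫⁻_s` is prime to `𝔠_ω` and `𝔫⁻_r` is only
divisible by prime factors of `𝔠_ω` … `A(χ) = {v ∈ 𝐡 ∣ 𝓚_v is a field, π_v is special and c_v(χ) = 0}`";
[p. 11 ll. 1–6] (§3.5 Running assumptions): "we will assume Hypothesis A for `(π, χ)` and (sf). The assumption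
(sf) implies that `π_v` is an unramified special representation if `v ∣ 𝔫⁻_s` … We shall write
`π_v = π(μ_v, ν_v)` such that `L(s, π_v) = L(s, μ_v)` for `v ∣ 𝔫⁻`. Moreover, by the local root number formulas
[Jacquet–Langlands], under the assumption (sf) Hypothesis A on the sign of local root numbers is equivalent
to the following condition: **(R1)** For each `v ∈ A(χ)`, `v` is RAMIFIED in `𝓚` and `μ′_v χ_v(ϖ_{𝓚_v}) =
−|ϖ|^{1/2}` (`μ′_v = μ_v ∘ N_{𝓚_v/𝓕_v}`)" (the right-hand side of the (R1) display is garbled in the held TeX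
text; it is RECONSTRUCTED here from the local root number of a special representation, `ε(½, σ(μ₁, μ₂) ⊗ ν, ψ)
= −μ₁ν(ϖ)|ϖ|^{−1/2}` for `μ₁ν` unramified, `μ₁μ₂⁻¹ = |·|` — Jacquet–Langlands 1970 Prop. 3.6, Bump 1997
(5.52)–(5.53), R. Schmidt 2002 Table "`ε(½, μSt) = −μ(ϖ)`", exactly the formula of the frame file's (E1));
§3.6.3 [p. 11 ll. 66–80] and §3.8 [pp. 13–16] (the toric Whittaker functions and period integrals "in the inert
and ramified case", with the case `v ∣ 𝔫⁻_s` [p. 15 l. 67]); [p. 17 l. 5]: "`C′(π, χ)` is actually a unit as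
`p > 2` and `(p, ℭ𝔫⁻) = 1`"; proof of Lemma 5.4 [p. 23 ll. 27–29]: "If `v` is inert or ramified, then `φ_v = 1`
as `φ_v` is unramified and `p > 2`" (for every anticyclotomic `φ` of `p`-power conductor [p. 23 ll. 20–22]) and
"Note that Hypothesis A and (sf) also hold for `(π, λφ)`" [p. 23 l. 22]; Thm. 6.1 [p. 25 l. 23] ("Suppose that
`p` is unramified in `𝓕`. Then `μ⁻_{π,λ,Σ} = inf … v_p(𝐚_β(𝐟*_{λ,u}, 𝔠(a)))`"), Thm. 6.2 [p. 25 ll. 68–72] ("In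
addition to Hypothesis A and (sf), we suppose that `p` is unramified in `𝓕` and the residual Galois
representation `ρ̄_p(π_𝓚)` is absolutely irreducible. Then `μ⁻_{π,λ,Σ} = 0` if and only if
`Σ_{v∣𝔠_λ⁻} μ_p(χ_v) = 0`") and Remark 6.4 [p. 26 l. 72] ("The assumption (3) in Theorem B implies the vanishing
of `μ_p(χ_v)` for all `v ∣ 𝔠_λ⁻`"): NO hypothesis on `𝔫⁻` beyond Hypothesis A and (sf) enters §5–§6.

## What is typed: the companions' statements with (S4) replaced by (S4′); why each clause follows

(S4′) THE CONFIGURATION (replacing (S4) `𝔫⁻ = 1`). `π = π_f`, `f ∈ S_2(Γ₀(N))` the newform of an elliptic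
curve `E = W/ℚ` (`IsNewformOf W f`: `a_n(f) = a_n(W)`), and a prime `q` with: `q ≠ p`; `q ∣ N`, `q² ∤ N`
(`q ‖ N`); `q ∣ d_K` (`(q : ℤ) ∣ NumberField.discr K`: `q` RAMIFIED in `K`, Dedekind); `W` has multiplicative,
NOT split multiplicative, reduction at `q` (`W.HasMultiplicativeReductionAtPrime q ∧
¬ W.HasSplitMultiplicativeReductionAtPrime q`, i.e. `a_q(E) = −1`: Silverman, AEC (2009) App. C §16 p. 449 ("`L_v(T) = 1 + T` at nonsplit multiplicative `v`"), Mathlib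
`WeierstrassCurve.localPolynomial` = `1 + X` at such a prime); every prime `ℓ ∣ N`, `ℓ ≠ q`, SPLITS in `K`
(`((Ideal.span {(ℓ:ℤ)}).primesOver (𝓞 K)).ncard = 2`; this includes `ℓ = p` when `p ∣ N`, consistently with the
binder "`p` splits"). These are exactly the local data of `friedbergHoffstein_exists_twist_ne_zero_ramifiedAt_splitAt`
and of the consumer's `TameRoadField`/`WanPrime`. Then, in Hsieh's notation at `𝓕 = ℚ`: `𝔫 = N`, `𝔫⁻ = q`
(the only prime of `N` not split in `K`; it is ramified), so **(sf) holds** (`q ‖ N`); `ω = 1` gives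
`𝔫⁻_r = 1`, `𝔫⁻ = 𝔫⁻_s = q` and `π_q = σ(μ₀|·|^{1/2}, μ₀|·|^{−1/2})` the special representation with `μ₀`
UNRAMIFIED, `μ₀(ϖ_q) = a_q(f) ∈ {±1}` (trivial character, `q ‖ N`; `L(s, π_q) = L(s, μ₀|·|^{1/2})`, i.e.
`L_q(f, s) = (1 − a_q q^{−s})⁻¹`) — Hsieh's "unramified special representation if `v ∣ 𝔫⁻_s`" [p. 11 l. 2].
**Hypothesis 1 (= A) holds, and is EXACTLY the non-split clause.** The only place of `𝔫⁻` is `v = q`, with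
`𝓚_v = K_𝔮` the RAMIFIED quadratic extension of `ℚ_q` (`𝔮² = q𝒪_K`, `𝔮̄ = 𝔮`, residue degree `1`, so
`N_{K_𝔮/ℚ_q}(ϖ_𝔮)` is a uniformizer of `ℚ_q`). (i) `λ_𝔮 = 1` on `K_𝔮^×`: `λ` is unramified at `𝔮 ∤ p` (binder
(S6)), trivial on `ℚ_q^×` (`λ|_{𝔸_ℚ^×} = 1`, (S3)), and `K_𝔮^×/(ℚ_q^× 𝒪_𝔮^×) ≅ ℤ/2` (generated by `ϖ_𝔮`,
`ϖ_𝔮² ∈ q·𝒪_𝔮^×`), while by Hsieh's dictionary [p. 3 ll. 28–30] `λ_𝔮(ϖ_𝔮) = ι⁻¹(λ̂(rec_𝓚(ϖ_𝔮)))` is a value of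
the avatar `λ̂`, a continuous character of the pro-`p` group `Γ⁻ ≅ ℤ_p` (binder (S7) `FactorsThroughZp κ r_λ`),
which has no value of order `2` (`p` odd) — verbatim Hsieh's "If `v` is inert or ramified, then `φ_v = 1` as
`φ_v` is unramified and `p > 2`" [p. 23 ll. 27–29] (equivalently: `Frob_𝔮 = 1` in `Γ⁻`, since the
decomposition group of `q` in the dihedral `Gal(K⁻_∞/ℚ) = Γ⁻ ⋊ ⟨c⟩` contains the inertia `⟨c̃⟩` of order `2` as a
normal subgroup, so `Frob_𝔮` commutes with `c̃`, which acts on `Γ⁻` by inversion). (ii) Base change to the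
ramified `K_𝔮`: `π_{𝓚,𝔮} = σ(μ₀′|·|^{1/2}, μ₀′|·|^{−1/2})`, `μ₀′ = μ₀ ∘ N_{K_𝔮/ℚ_q}` unramified with `μ₀′(ϖ_𝔮) =
μ₀(N ϖ_𝔮) = μ₀(ϖ_q) = a_q(f)` (restriction of the Weil–Deligne representation `μ₀ ⊗ sp(2)` to `W_{K_𝔮}`; Hsieh's
`μ′_v = μ_v ∘ N_{𝓚_v/𝓕_v}` in (R1)). (iii) Hence `ε*(π_{𝓚_𝔮}, λ_𝔮) = ε(½, σ_{K_𝔮}(μ₀′|·|^{1/2}, μ₀′|·|^{−1/2}) ⊗ 1,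
ψ)·ω_q(−1) = −μ₀′(ϖ_𝔮) = −a_q(f)` (the special-representation root number formula recalled above; `ω = 1`; the
value at `s = ½` does not depend on `ψ` [p. 3 l. 19]). So Hypothesis 1 ⟺ `a_q(f) = −1` ⟺ `a_q(W) = −1` ⟺ `W`
has NON-SPLIT multiplicative reduction at `q` — Hsieh's (R1) read at `v = q ∈ A(λφ)`: "`v` is ramified in `𝓚`"
(true: `q ∣ d_K`) "and `μ′_v χ_v(ϖ_{𝓚_v}) = −|ϖ|^{1/2}`" (`χ_v = λ_vφ_v = 1` by (i) and [p. 23 ll. 27–29], `μ_v =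
μ₀|·|^{1/2}`: the condition reads `a_q = −1`). At an INERT Steinberg prime (R1) fails ("`v` is ramified"), which
is why the item and this file require `q ∣ d_K`; the consumer's card records the same computation ("Hypothesis A
at the ramified Steinberg place `q` is EXACTLY `a_q(E) = −1`", `wan_tame_bdp_road.lean` ll. 27–31, 82–84).
(ord) ⟺ `p` splits (S2), unchanged. THEOREM 2's extra hypotheses: (1) vacuous (`𝓕 = ℚ`); (2) = the binder
"every framed mod-`p` representation of `E/K` is absolutely irreducible" of the Thm. B companions, verbatim;
(3) vacuous: `𝔠_λ` is supported at the two primes above `p`, both SPLIT, so `𝔠_λ⁻ = (1)` (the ramified `𝔮`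
divides `𝔫`, not `𝔠_λ`: `λ_𝔮 = 1`) — and by Thm. 6.2 [p. 25] with Remark 6.4 [p. 26] `μ⁻_{π,λ,Σ} = 0` iff the
EMPTY sum `Σ_{v∣𝔠_λ⁻} μ_p(χ_v)` vanishes.
THE LEVEL AWAY FROM `q`. (S6) becomes: `𝔑` (the prime-to-`p` conductor of `π_𝓚 ⊗ λ` [p. 4 l. 1]) has
`𝔑⁻ = 𝔮` (conductor of `St_{K_𝔮} ⊗` unramified `= 𝔮¹`) and `𝔑⁺ = ∏_{ℓ^e ‖ N, ℓ ∉ {p, q}} ℓ^e 𝒪_K = ℭℭ̄` with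
`(ℭ, ℭ̄) = 1` EXISTS because every such `ℓ` splits (`ℭ = ∏ 𝔩_ℓ^e` for a choice of `𝔩_ℓ ∣ ℓ`); `ℭ` is eliminated by
(W3) exactly as before (`φ(ℭ)` is an avatar value at a FIXED element of `Γ⁻`). The polarization datum of
(W4) is unchanged: `δ = c/(2√d_K)` with `c ∈ ℤ` prime to `pN` of the right sign gives `𝔠(𝒪_K) = (2δ)𝒟_{K/ℚ} =
(c)`, prime to `p𝔑𝔑̄ ∋ 𝔮` [p. 4 ll. 4–7] since `q ∣ N`; `A := Im σ̄₀(δ) > 0` (times `p^{(1−a)/2}` at `v_p(N) = a`,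
(E1″)), `−2δ` a unit above `p` ((E2)). ANY LEVEL AT `p`: (E1), (E1″), (E2) concern the places above the
split prime `p ≠ q` only and are reused verbatim (so `p² ∣ N` is allowed, as in the any-level companions — the
consumer's `E` is additive at `p`).
THE DISPLAY IS HONEST AT `𝔮` (the one new check relative to (S8), whose "every Euler factor honest because
every `ℓ ∣ N` splits" no longer applies literally). Hsieh's `L(s, π_𝓚 ⊗ χ)` is "the meromorphic continuation of
the Euler product of local `L`-functions at ALL finite places" [p. 3 ll. 5–6]; the tree's
`rankinSelbergValueHecke f χ 1` is the value at `s = 1` of the continuation of `∏_v (rankinSelbergLocalFactorInvHecke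
f χ v s)⁻¹` (`BDPAnticyclotomicPAdicLFunction.lean`), whose factor at `v` with `N(v) = ℓ^k` is
`1 − (α^k + β^k) w X + (αβ)^k w² X²`, `α + β = a_ℓ(f)`, `αβ = ℓ·𝟙_{ℓ∤N}`, `w = χ(ϖ_v)`, `X = N(v)^{−s}`. At
`v = 𝔮`: `N(𝔮) = q`, `k = 1`, `αβ = 0` (`q ∣ N`), so the factor is `1 − a_q(f)·χ_𝔮(ϖ_𝔮)·q^{−s}` — and this IS
the local factor of `π_{𝓚,𝔮} ⊗ χ_𝔮 = σ(μ₀′χ_𝔮|·|^{1/2}, μ₀′χ_𝔮|·|^{−1/2})` in the arithmetic normalisation: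
`L(s − ½, σ ⊗ χ_𝔮) = L(s, μ₀′χ_𝔮) = (1 − μ₀′χ_𝔮(ϖ_𝔮) q_𝔮^{−s})⁻¹ = (1 − a_q χ_𝔮(ϖ_𝔮) q^{−s})⁻¹` (`q_𝔮 = q`; on the
Galois side: the `I_𝔮`-invariants of `V_f ≅ μ₀ ⊗ sp(2)` are the line `ker N`, the same as the `I_q`-invariants,
with `Frob_𝔮 = Frob_q` acting by the unramified eigenvalue since the residue degree is `1`). At every other
place the factors are those of (S8) (split primes of `N`; unramified places, split, inert or ramified, where
the tree's polynomial is the characteristic polynomial of `Frob_v = Frob_ℓ^{f_v}` on the unramified `V_f ⊗ χ`). So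
`L(½, π_𝓚 ⊗ χ) = rankinSelbergValueHecke f χ 1` on the typed range, as in (S8). (On that range `χ_𝔮(ϖ_𝔮) = 1`
by (i) applied to `χ̂`, so the factor at `𝔮` is the constant `(1 + q⁻¹)⁻¹` — not used.) The constant: Thm. 1
prints `C(π, λ) ∈ Z̄_{(p)}^×` "consisting of a product of local epsilon factors outside `p`" [p. 4 l. 18] under
its own hypotheses, which now include the place `𝔮` — its unit property is PRINTED ([p. 17 l. 5]: "`C′(π, χ)` is
actually a unit as `p > 2` and `(p, ℭ𝔫⁻) = 1`", here `(p, 𝔫⁻) = (p, q) = 1`), so the typed `‖ι⁻¹ C‖_p = 1` of (W3)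
stands (in print the unit is normalised into `ℒ_{Σ_p}(π, λ)`, ERRATUM E-G131-1 — either way). Everything else —
(S1)–(S3), (S5) dropped by (E1″), (S7), (S8), (W1)–(W4), (E1), (E1″), (E2), the `R₀`-unit period [p. 23 l. 64] —
is the companions', unchanged and not restated.

WEAKER than print on its range (special case `𝓕 = ℚ`, `κ = 2`, `π = π_{f_E}`, `𝔫⁻` = one ramified prime,
unramified critical characters, consequence-shaped conclusions), never stronger. NOT typed, NOT asserted (as
in the companions, verbatim): `Q ∈ R₀⟦T⟧`; any comparison of an `IsHsiehLFunction` frame with the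
Castella-normalised `IsBDPLFunction` frame, with Liu–Zhang–Zhang's `p`-adic Waldspurger formula or with the
Jetchev–Skinner–Wan / Wan normalisations (the consumer's PORT-1); the typed `A`, `Ω_K`, `Ω_p`, `C`, `Q` are not
the printed canonical objects (frame file, caveat of record). Statement/port file: no `instance`, no notation,
no attribute changes; the two `def`s are the only declarations (the corollaries are proved in the sibling file).
-- TODO(general form): Hsieh's Thm. 1–2 for a totally real `𝓕`, CM type `Σ`, parallel weight `κ`, any
-- square-free `𝔫⁻` under Hypothesis A (several inert/ramified places, `𝔫⁻_r ≠ 1`), `λ` with `𝔠_λ⁻ ≠ (1)` under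
-- hypothesis (3), and the full range `φ̂ ∈ 𝔛` — needs local `ε`-factors of `GL₂` as tree objects.

## References

* [Hsieh2014] M.-L. Hsieh, *Special values of anticyclotomic Rankin–Selberg L-functions*, Doc. Math. 19 (2014)
  709–767 = arXiv:1112.1580: Thm. 1 [pp. 3–4] = Thm. A (p. 712) = Thm. 5.6 [p. 23] = Thm. 5.7 (p. 754); Thm. 2
  [p. 4 ll. 31–37] = Thm. B (p. 713) = Thm. 6.2 [p. 25]; `𝔞 = 𝔞⁺𝔞⁻` and Hypothesis 1 [p. 3 ll. 14–22]; `A(χ)`,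
  `𝔫⁻ = 𝔫⁻_s𝔫⁻_r` [p. 10]; §3.5 (sf) ⟹ "unramified special", (R1) [p. 11 ll. 1–6]; §3.6.3, §3.8 [pp. 11–16];
  `C′(π, χ)` a unit [p. 17 l. 5]; proof of Lemma 5.4 [p. 23 ll. 24–29]; Thm. 6.1, Thm. 6.2, Remark 6.4
  [pp. 25–26] — read 2026-08-28 from the store text `paper:arxiv-1112.1580` (chunks 3–5, 10–17, 23, 25–26).
* [JacquetLanglands1970] H. Jacquet, R. P. Langlands, *Automorphic forms on GL(2)*, LNM 114, Prop. 3.6 (`ε` of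
  special representations); [Bump1997] D. Bump, *Automorphic forms and representations*, (5.52)–(5.53) p. 337;
  [Schmidt2002] R. Schmidt, J. Ramanujan Math. Soc. 17 (2002), Table of local factors (`ε(½, μSt) = −μ(ϖ)`,
  `L(s, μSt) = L(s + ½, μ)` hence `a(μSt_E) = 1` for unramified `μ`).
* [SilvermanAEC2009] J. H. Silverman, *The arithmetic of elliptic curves*, 2nd ed., GTM 106 (2009), App. C §16
  p. 449 (`L_v(T) = 1 + T`, i.e. `a_q = −1`, at a prime of non-split multiplicative reduction; held text chunk 390;
  Mathlib `WeierstrassCurve.localPolynomial`).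
* [Marcus2018] D. A. Marcus, *Number fields*, Universitext (2018), Ch. 3: Thm. 21 (`Σ eᵢfᵢ = n`, held text p. 58),
  Thm. 34 (`p ∣ disc(R)` ⟹ `p` ramified, p. 92; converse Thm. 24, p. 61), Thm. 25 (`pR = (p, √m)²` for `p ∣ m`,
  p. 63) — here Mathlib `NumberField.not_dvd_discr_iff_forall_liesOver` and `Ideal.sum_ramification_inertia`;
  tree sibling in the place-indexed currency: `exists_unique_place_of_dvd_discr`
  (`QuadraticTwistRamifiedLocalPolynomialProofs.lean`).
* [CastellaHsieh2018] F. Castella, M.-L. Hsieh, Math. Ann. 370 (2018) §2.5 (the periods `(Ω_K, Ω_p) ∈ ℂ^× × 𝒲^×`).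
* Tree: `AnticyclotomicRankinSelbergPAdicLFunction.lean` (frame, (S1)–(S8), (W1)–(W4), (E1)–(E2)),
  `Hsieh2014/AnticyclotomicPAdicLFunctionAnyLevel.lean` ((E1″), Thm. A any level),
  `Hsieh2014/AnticyclotomicMuInvariantAnyLevel.lean` (Thm. B any level), `Hsieh2014/AnticyclotomicMuInvariant.lean`
  (`ne_zero_of_coeff_norm_eq_one`), `UnrIntegersUnits.lean` (`unrIntegers.isUnit_iff_norm_eq_one`),
  `BDPAnticyclotomicPAdicLFunction.lean` (`rankinSelbergLocalFactorInvHecke`, `rankinSelbergValueHecke`),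
  `PAdicHeights.lean` / `Tamagawa.lean` (the reduction-type predicates), `HeegnerPoints.lean`
  (`SatisfiesHeegnerHypothesis`, `IsImaginaryQuadratic`), `NonvanishingTwistsPrescribedRamificationSplit.lean`
  (the consumer's field), the consumer line `Cruxes/GordTwoRankOne/Lines/wan_tame_bdp_road.lean`; sibling proof file
  `Hsieh2014/AnticyclotomicPAdicLFunctionRamifiedSteinbergCorollaries.lean` (the corollaries and the disjointness lemma).
-/

noncomputable section

open scoped MatrixGroups ModularForm Topology NumberField
open CongruenceSubgroup NumberField IsDedekindDomain Field
open Literature.NumberTheory.GaloisRepresentations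
open Literature.NumberTheory.EllipticCurves.ModularForms
open Literature.NumberTheory.Automorphic

namespace Literature.NumberTheory.EllipticCurves.Hsieh2014

/-! ### §1. Theorem A (= Thm. 1) with one `K`-ramified Steinberg prime -/

/-- **Hsieh, Doc. Math. 19 (2014), Theorem A (p. 712) = Thm. 1 [arXiv:1112.1580 pp. 3–4] = Thm. 5.6 [p. 23], WITH
THE `p`-ADIC CM PERIOD IN `𝒲^× = R₀^×`, AT ANY LEVEL AT `p`, FOR `𝔫⁻ = 𝔮` ONE `K`-RAMIFIED STEINBERG PRIME** — the
named fact `thmA_exists_isHsiehLFunction_unrPeriod_anyLevel` VERBATIM (same binders in the same order, same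
conclusion `∃ A Ω_K C Ω_p Q, 0 < A ∧ Ω_K ≠ 0 ∧ ‖ι⁻¹C‖ = 1 ∧ IsHsiehLFunction ι 𝔭 κ γ f A Ω_K C Ω_p Q` with
`Ω_p : (unrIntegers p)ˣ`, `Q : PowerSeries (PadicComplexInt p)`), EXCEPT: (a) `f` is the newform of an elliptic
curve `W/ℚ` (`IsNewformOf W f` in place of `IsNewform0 f`, as in the Thm. B companions — needed to phrase (b));
(b) the binder (S4) `SatisfiesHeegnerHypothesis N K` is REPLACED by the configuration (S4′) of the module
docstring at a prime `q`: `q ≠ p`, `q ∣ N`, `¬ q² ∣ N`, `(q : ℤ) ∣ d_K` (ramified), `W` multiplicative and not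
split multiplicative at `q` (`a_q = −1`), every `ℓ ∣ N` with `ℓ ≠ q` split in `K`. Justification (module
docstring): then `𝔫⁻ = q` is square-free ((sf)), `π_q` is the unramified special representation `σ(μ₀|·|^{1/2},
μ₀|·|^{−1/2})`, `μ₀(ϖ_q) = a_q` [p. 11 l. 2], and Hypothesis 1 at the unique place `𝔮 ∣ q` of `K` holds
EXACTLY because `a_q = −1`: `λ_𝔮 = 1` ([p. 23 ll. 27–29]: an unramified anticyclotomic character of `p`-power
conductor is trivial at a non-split place, `p > 2`), the base change of `π_q` to the RAMIFIED `K_𝔮` is special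
with unramified character `μ₀ ∘ N`, `(μ₀ ∘ N)(ϖ_𝔮) = a_q`, and `ε(½, μSt_{K_𝔮}, ψ) = −μ(ϖ_𝔮)` (Jacquet–Langlands
Prop. 3.6) gives `ε*(π_{𝓚_𝔮}, λ_𝔮) = −a_q = +1` — Hsieh's own criterion (R1) [p. 11 ll. 3–6] ("`v` ramified in `𝓚`
and `μ′_vχ_v(ϖ_{𝓚_v}) = −|ϖ|^{1/2}`"); the display `IsHsiehLFunction` is honest at `𝔮` (the tree's Euler factor
`1 − a_q χ_𝔮(ϖ_𝔮) q^{−s}` at `𝔮` is the local factor of `St_{K_𝔮} ⊗ (μ₀∘N)χ_𝔮`), `C(π, λ) ∈ Z̄_{(p)}^×` as printed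
[p. 4 l. 18, p. 17 l. 5], `𝔑⁻ = 𝔮`, `𝔑⁺ = ℭℭ̄` from the split primes, `𝔠(𝒪_K) = (c)` prime to `p𝔑𝔑̄`; the rest —
(S1)–(S3), (S6)–(S8), (W1)–(W4), (E1), (E1″), (E2), the `R₀`-unit period — is the companions', verbatim. WEAKER
than print on its range (special case), never stronger; DISJOINT from the all-split facts
(`not_satisfiesHeegnerHypothesis_of_dvd_discr`, sibling proof file). NOT asserted: `Q ∈ R₀⟦T⟧` (module docstring). Named fact;
nothing asserted; no `_holds`.
[cite: Hsieh2014, Thm. A p. 712 (Doc. Math. 19) = Thm. 1 (arXiv:1112.1580 pp. 3–4), p. 3 ll. 14–22 (𝔫⁻, Hyp. 1), p. 4 ll. 13–22 ((sf); 𝔫⁻ ramified in scope), §3.5 (R1) (p. 11 ll. 1–6), §3.6.3/§3.8 (pp. 11–16), p. 17 l. 5, proof of Lemma 5.4 (p. 23 ll. 24–29), p. 23 l. 64]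
[cite: JacquetLanglands1970, Prop. 3.6] [cite: Bump1997, (5.52)–(5.53) p. 337] [cite: SilvermanAEC2009, App. C §16 p. 449 (L_v(T) = 1 + T at a prime of nonsplit multiplicative reduction)]
[cite: CastellaHsieh2018, §2.5 (arXiv:1505.08165 p. 7)] -/
def thmA_exists_isHsiehLFunction_unrPeriod_ramifiedSteinberg : Prop :=
  ∀ {p : ℕ} [Fact p.Prime] (ι : PadicAlgCl p ≃+* ℂ) (K : Type) [Field K] [NumberField K]
    (𝔭 : HeightOneSpectrum (𝓞 K)) (κ : ZpExtension K p) (γ : absoluteGaloisGroup K)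
    {N : ℕ} [NeZero N] (W : WeierstrassCurve ℚ) [W.IsElliptic] (f : CuspForm (Gamma0 N) 2)
    (q : ℕ) [Fact q.Prime] (lam : HeckeCharacter K) (rlam : FramedGaloisRep K (PadicAlgCl p) 1),
    p ≠ 2 → IsNewformOf W f →
    IsImaginaryQuadratic K → ((Ideal.span {(p : ℤ)}).primesOver (𝓞 K)).ncard = 2 →
    ((p : ℕ) : 𝓞 K) ∈ 𝔭.asIdeal →
    (∀ (w : InfinitePlace K) (k : 𝓞 K), k ∈ 𝔭.asIdeal ↔ ‖ι.symm (w.embedding (k : K))‖ < 1) →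
    q ≠ p → q ∣ N → ¬ q ^ 2 ∣ N → (q : ℤ) ∣ NumberField.discr K →
    W.HasMultiplicativeReductionAtPrime q → ¬ W.HasSplitMultiplicativeReductionAtPrime q →
    (∀ ℓ : ℕ, ℓ.Prime → ℓ ∣ N → ℓ ≠ q → ((Ideal.span {(ℓ : ℤ)}).primesOver (𝓞 K)).ncard = 2) →
    lam.IsUnitary → lam.HasInfinityType (fun _ ↦ (1 : ℤ)) (fun _ ↦ (-1 : ℤ)) →
    (∀ x : ideleGroup ℚ, lam (AdeleRing.ideleBaseChange ℚ K x) = 1) →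
    (∀ v : HeightOneSpectrum (𝓞 K), ((p : ℕ) : 𝓞 K) ∉ v.asIdeal → lam.IsUnramifiedAt v) →
    IsPAdicAvatarOf ι lam rlam → FactorsThroughZp κ rlam →
    κ.IsAnticyclotomic → κ.IsTopGenerator γ →
    ∃ (A : ℝ) (ΩK C : ℂ) (Ωp : (unrIntegers p)ˣ) (Q : PowerSeries (PadicComplexInt p)),
      0 < A ∧ ΩK ≠ 0 ∧ ‖((ι.symm C : PadicAlgCl p) : ℂ_[p])‖ = 1 ∧
        IsHsiehLFunction ι 𝔭 κ γ f A ΩK C ((Ωp : unrIntegers p) : ℂ_[p]) Q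

/-! ### §2. Theorem B (= Thm. 2 = Thm. 6.2) with one `K`-ramified Steinberg prime -/

/-- **Hsieh, Doc. Math. 19 (2014), Theorem B (p. 713) = Thm. 2 [arXiv:1112.1580 p. 4 ll. 31–37] = Thm. 6.2 [p. 25],
WITH THE `p`-ADIC CM PERIOD IN `𝒲^× = R₀^×`, AT ANY LEVEL AT `p`, FOR `𝔫⁻ = 𝔮` ONE `K`-RAMIFIED STEINBERG PRIME**
— the named fact `thmB_exists_isHsiehLFunction_coeff_norm_eq_one_unrPeriod_anyLevel` VERBATIM (same binders in the
same order, same conclusion: a frame `(A, Ω_K, C, Ω_p, Q)` with `IsHsiehLFunction ι 𝔭 κ γ f A Ω_K C Ω_p Q` AND a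
coefficient of `Q` of norm one, i.e. `Q ≢ 0 (mod 𝔪_{ℂ_p})`, the consequence of `μ⁻_{π_f,λ,Σ} = 0`), EXCEPT that
the binder (S4) `SatisfiesHeegnerHypothesis N K` is REPLACED by the configuration (S4′) of the module docstring
(`q ≠ p`, `q ‖ N`, `q ∣ d_K`, `W` non-split multiplicative at `q`, every other `ℓ ∣ N` split), under which
"the assumptions in Theorem 1" hold as explained at `thmA_exists_isHsiehLFunction_unrPeriod_ramifiedSteinberg`
((sf): `𝔫⁻ = q` square-free; Hypothesis A ⟺ `a_q = −1` by (R1) [p. 11 ll. 3–6] and `λ_𝔮 = 1` [p. 23 ll. 27–29]),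
and Theorem 2's further hypotheses read: (1) `p` unramified in `𝓕 = ℚ` — vacuous; (2) `ρ̄_p(π_𝓚) =
ρ̄_{E,p}|_{G_K}` absolutely irreducible — the binder "every framed mod-`p` representation of `E/K` is absolutely
irreducible", verbatim; (3) `p ∤ ∏_{v∣𝔠_λ⁻} #Δ_{λ,v}` — vacuous, `𝔠_λ⁻ = (1)` (`λ` unramified outside the two
SPLIT primes above `p`; `𝔮` divides `𝔫`, not `𝔠_λ`); and §6 carries no hypothesis on `𝔫⁻` beyond Hypothesis A
and (sf): Thm. 6.1 [p. 25] ("`p` unramified in `𝓕`"), Thm. 6.2 [p. 25] ("`μ⁻_{π,λ,Σ} = 0` iff `Σ_{v∣𝔠_λ⁻}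
μ_p(χ_v) = 0`", an EMPTY sum here), Remark 6.4 [p. 26]. WEAKER than print on its range (special case `𝓕 = ℚ`,
`κ = 2`, `π = π_{f_E}`, unramified critical characters, consequence-shaped conclusion), never stronger;
DISJOINT from the all-split facts (`not_satisfiesHeegnerHypothesis_of_dvd_discr`, sibling proof file); yields a Thm. A-shaped frame
and a frame with `Q ≠ 0` (sibling proof file `AnticyclotomicPAdicLFunctionRamifiedSteinbergCorollaries.lean`).
Named fact; nothing asserted; no `_holds`.
[cite: Hsieh2014, Thm. B p. 713 (Doc. Math. 19) = Thm. 2 (arXiv:1112.1580 p. 4 ll. 31–37), §3.5 (R1) (p. 11 ll. 1–6), proof of Lemma 5.4 (p. 23 ll. 24–29), Thm. 6.1–6.2 (p. 25), Remark 6.4 (p. 26), p. 23 l. 64]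
[cite: JacquetLanglands1970, Prop. 3.6] [cite: SilvermanAEC2009, App. C §16 p. 449 (L_v(T) = 1 + T at a prime of nonsplit multiplicative reduction)] [cite: CastellaHsieh2018, §2.5 (arXiv:1505.08165 p. 7)] -/
def thmB_exists_isHsiehLFunction_coeff_norm_eq_one_unrPeriod_ramifiedSteinberg : Prop :=
  ∀ {p : ℕ} [Fact p.Prime] (ι : PadicAlgCl p ≃+* ℂ) (K : Type) [Field K] [NumberField K]
    (𝔭 : HeightOneSpectrum (𝓞 K)) (κ : ZpExtension K p) (γ : absoluteGaloisGroup K)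
    {N : ℕ} [NeZero N] (W : WeierstrassCurve ℚ) [W.IsElliptic] (f : CuspForm (Gamma0 N) 2)
    (q : ℕ) [Fact q.Prime] (lam : HeckeCharacter K) (rlam : FramedGaloisRep K (PadicAlgCl p) 1),
    p ≠ 2 → IsNewformOf W f →
    IsImaginaryQuadratic K → ((Ideal.span {(p : ℤ)}).primesOver (𝓞 K)).ncard = 2 →
    ((p : ℕ) : 𝓞 K) ∈ 𝔭.asIdeal →
    (∀ (w : InfinitePlace K) (k : 𝓞 K), k ∈ 𝔭.asIdeal ↔ ‖ι.symm (w.embedding (k : K))‖ < 1) →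
    q ≠ p → q ∣ N → ¬ q ^ 2 ∣ N → (q : ℤ) ∣ NumberField.discr K →
    W.HasMultiplicativeReductionAtPrime q → ¬ W.HasSplitMultiplicativeReductionAtPrime q →
    (∀ ℓ : ℕ, ℓ.Prime → ℓ ∣ N → ℓ ≠ q → ((Ideal.span {(ℓ : ℤ)}).primesOver (𝓞 K)).ncard = 2) →
    (∀ ρ : ModPGaloisRep K (ZMod p) 2, (W.baseChange K).IsTorsionGaloisRep p ρ →
      FramedRep.IsAbsolutelyIrreducible ρ) →
    lam.IsUnitary → lam.HasInfinityType (fun _ ↦ (1 : ℤ)) (fun _ ↦ (-1 : ℤ)) →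
    (∀ x : ideleGroup ℚ, lam (AdeleRing.ideleBaseChange ℚ K x) = 1) →
    (∀ v : HeightOneSpectrum (𝓞 K), ((p : ℕ) : 𝓞 K) ∉ v.asIdeal → lam.IsUnramifiedAt v) →
    IsPAdicAvatarOf ι lam rlam → FactorsThroughZp κ rlam →
    κ.IsAnticyclotomic → κ.IsTopGenerator γ →
    ∃ (A : ℝ) (ΩK C : ℂ) (Ωp : (unrIntegers p)ˣ) (Q : PowerSeries (PadicComplexInt p)),
      0 < A ∧ ΩK ≠ 0 ∧ ‖((ι.symm C : PadicAlgCl p) : ℂ_[p])‖ = 1 ∧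
        IsHsiehLFunction ι 𝔭 κ γ f A ΩK C ((Ωp : unrIntegers p) : ℂ_[p]) Q ∧
        ∃ n : ℕ, ‖((PowerSeries.coeff n Q : PadicComplexInt p) : ℂ_[p])‖ = 1

end Literature.NumberTheory.EllipticCurves.Hsieh2014

end
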